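import Summits.HodgeConjecture.HodgeConjecture.Theorems.F0P3KitOfRecordLawsV8W              -- ★6 (w2) (the `h2` edition): `laws₈_kitOfRecordW_of₄`, `routing₈_…`; same imports ∕ opens
import Summits.HodgeConjecture.HodgeConjecture.Theorems.F0P3InnerFormClassificationV83      -- ★ (E-2) (this seat): `shapeGuarded₃_of_T5`
import Summits.HodgeConjecture.HodgeConjecture.Theorems.F0P3GuardedLettersOfGuardedShape3   -- ★ (E-3b) (p03 (g4)): `letters_of_guardedEngine₃`
import Summits.HodgeConjecture.HodgeConjecture.Theorems.F0P3ThreadLetters3Defs             -- ★ p864888: `KitFamilyLaws₃`, `StubE1coh₃`, `HodgeTypeRigid₃` (S5-R20: ONE text home, BY NAME)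
import HarnessLib

/-!
# Crux `H413` — ★6 «REL♯-W» (w2), TWO-COMPACT-PLACE TWIN (R90-TF THREAD-₃ lane 2, file (E-1)): the ₃ LAWS and the HJ3a LETTERS `StubE1coh₃ ∧ HodgeTypeRigid₃`
# at the W-family of record — `letters_of_kitFamilyOfRecordV8W₃`, `letters_of_specPkgV8W_cot₃` (the head AGG's ₃ edition consumes at :651)

F0∕P3 «U3-mult», cell `hodgecm-mathlib`, crux H413 (`stmt-HodgeConjecture-24833`); R90-TF slab S5, prover K2E3-p17 (g12), deal (H26) (S5 dealer R90-C133-plan (g3)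
2026-09-05T03:08:21Z ∕ 03:08:49Z «E-1 = ★ `F0P3KitOfRecordLawsV8W` twins … `letters_of_specPkgV8W_cot₃ : … → StubE1coh₃ ∧ HodgeTypeRigid₃` — the one AGG :651 consumes»);
census `R90/R90-C133-p01/g2/CENSUS-L7.md` 9974659a §3 (E-1); heir LEAD F0P3a-plan (g22) RULING (R-44) (C)(7); director (g40) s2043 (c)(ii)(iii); RULING S5-R19 «₃ twins live
Summits-side»; RULING S5-R20 «ONE TEXT HOME, TWO LANES».  THEOREMS ONLY (no `def`, no instance, no notation, no `sorry`); ADDITIVE (a new module beside ★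
`F0P3KitOfRecordLawsV8W`, which is untouched and imported for `laws₈_kitOfRecordW_of₄`, the kit family ★ `kitFamilyOfRecordW` ∕ `isPinned_kitFamilyOfRecordW` and the opens);
`--supports stmt-HodgeConjecture-24833 --as helper`.  Sibling naming convention of the thread: `<★ source module>3`.
HONEST LABEL: this file pays nothing until AGG's ₃ edition (`Lines/F0_U3LettersRung1.lean` :651 `letters_of_rung0₃ := letters_of_specPkgV8W_cot₃ frameDataOfRung0 rows_of_rung0₃`)
consumes it; HC_CM is proved only modulo the 7 printed citations (2 remaining named inputs: hLiu418 = stmt-HodgeConjecture-24832, h413 = stmt-HodgeConjecture-24833) until rung 0 closes;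
count-neutral support (plumbing, no new mathematics).

WHY A TWIN.  The R90-TF road pays letter #80's finite-place organ from the Arthur-simple trace formula, which needs TWO compact real places of the definite unitary group
(`3 ≤ [L⁺:ℚ]`); AGG DERIVES E1_coh ∕ E2′ from the rung-0 rows (:651 ★ `letters_of_specPkgV8W_cot`), and with ₃ rows (law #15 Routing comes from `stub_L3₃`) the fourteen
conjuncts are available only at frames WITH TWO COMPACT PLACES, so the V8 engine chain runs in the ₃ currency: ★ (E-2) `shapeGuarded₃_of_T5` → ★ (E-3b)
`letters_of_guardedEngine₃` → (E-1) THIS FILE.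

WHAT CHANGES w.r.t. ★ `F0P3KitOfRecordLawsV8W` §3–§4 (everything else VERBATIM; the frame data `𝔇W`, the kit family ★ `kitFamilyOfRecordW 𝔇W`, its pin ★
`isPinned_kitFamilyOfRecordW` and the per-frame assembly ★ `laws₈_kitOfRecordW_of₄` are `h2` objects and stay — kits, pins and external data exist at every `h2` frame; only
the LAWS ∕ rows need `h3`):
* §3₃ `kitFamilyLaws₃_kitFamilyOfRecordW_of` (twin of ★ `lawsV8_kitFamilyOfRecordW_of` :122): `hL` gains the binder `(h3 : 3 ≤ …)` after `h2`; conclusion ↦ ★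
  `F0P3ThreadLetters3Defs.KitFamilyLaws₃ (kitFamilyOfRecordW 𝔇W)` BY NAME (★ V8 `KitFamily.Laws` body + the ONE `3 ≤` binder; definitional, proof `hL`).
* §3₃ `letters_of_kitFamilyOfRecordV8W₃` (twin of ★ :143): `hlaws : KitFamily.Laws …` ↦ `hlaws₃ : F0P3ThreadLetters3Defs.KitFamilyLaws₃ (kitFamilyOfRecordW 𝔇W)`; conclusion
  ↦ `F0P3ThreadLetters3Defs.StubE1coh₃ ∧ F0P3ThreadLetters3Defs.HodgeTypeRigid₃` BY NAME (= ★ (E-3b)'s conclusion; the Old spelled-out `StubE1coh` body ∧ Literature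
  `hodgeTypeRigid`, each + the ONE `3 ≤` line); proof ↦ ★ (E-3b) `letters_of_guardedEngine₃` ∘ ★ (E-2) `shapeGuarded₃_of_T5` at the SAME family and pin.
* §4₃ `letters_of_specPkgV8W_cot₃` (twin of ★ :232, THE HEAD AGG consumes): `h` gains the binder `(h3 : 3 ≤ …)` after `h2` — the fourteen conjuncts (witnessed `SpecPkg` + rows
  #1, TF, #2, #6, #7, #8, #10, #15 GUARDED, arch clauses, ξ-rows #20 #21 #23) are VERBATIM, each a statement about the kit ★ `kitFamilyOfRecordW 𝔇W L ι H T hT hdef h2 μ μω hμu hμω`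
  at that frame; conclusion as §3₃; proof :276–:283 VERBATIM with `h3` introduced beside `h2` and passed at the ONE application of `h`.
(The UNGUARDED v6-routing variant ★ `letters_of_specPkgV8W` :174 has no consumer on the ₃ road — AGG reads the `_cot` text — and is not twinned.)
PRINT-FAITHFULNESS (director s2043 (iii)): «`3 ≤ [F⁺:ℚ]` is implied by Hyp413 (`6 ≤ [F:ℚ]`); the weakening costs nothing at the summit; anchor [Rogawski1990 §13.3 (13.3.6(c)),
two compact places]» — the `3 ≤` clause is a ROUTE restriction of the R90-TF road, not a hypothesis of Rogawski's theorems.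
References: as in ★ `F0P3KitOfRecordLawsV8W` ([Rogawski1990] §14.6 Thm. 14.6.4 pp. 236–244, §13.8 Prop. 13.8.1, §15.3 ¶1 p. 244, Prop. 15.2.1 (b), §12.2 p. 174, §12.3 p. 178,
§13.1 Prop. 13.1.3 (d) p. 199, Thm. 13.3.6 (c); [Rogawski1992] Thm. 1.2 p. 397; [BorelWallach2000] VI Thm. 4.11; [FlathCorvallis1979] Thm. 3).
-/

set_option autoImplicit false
-- the mandated namespace repeats `HodgeConjecture.HodgeConjecture`, as in every `Theorems/*.lean` of this sub-problem
set_option linter.dupNamespace false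

noncomputable section

open NumberField IsDedekindDomain MeasureTheory
open Literature.NumberTheory.Rogawski1990 Literature.NumberTheory.GaloisRepresentations
open Literature.NumberTheory.Automorphic Literature.NumberTheory.Automorphic.UnitaryGroup
open Literature.NumberTheory.Automorphic.UnitaryGroup.CotangentForms
open Literature.RepresentationTheory.BorelWallach2000 Literature.RepresentationTheory.KonnoKonno2007
open scoped Matrix ComplexOrder
open Summit.HodgeConjecture.HodgeConjecture.Cruxes.H413.F0P3XiArchPacketOfRecord (JInfNoDegOne DsInfNoDegOne)

namespace Summit.HodgeConjecture.HodgeConjecture.Cruxes.H413.F0P3KitOfRecordLawsV8W3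

open Summit.HodgeConjecture.HodgeConjecture.Cruxes.H413.F0P3InnerFormClassificationV6 (Sockets Gp Places Cinf IsCot KcTrivial)
open Summit.HodgeConjecture.HodgeConjecture.Cruxes.H413.F0P3ClassTokensOfRecord (Cls cl rep mult)
open Summit.HodgeConjecture.HodgeConjecture.Cruxes.H413.F0P3GuardedLettersOfGuardedShape3 (letters_of_guardedEngine₃)
open Summit.HodgeConjecture.HodgeConjecture.Cruxes.H413.F0P3InnerFormClassificationV83 (shapeGuarded₃_of_T5)
open Summit.HodgeConjecture.HodgeConjecture.Cruxes.H413.F0P3KitOfRecord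
open Summit.HodgeConjecture.HodgeConjecture.Cruxes.H413.F0P3KitOfRecordW

/-! ## §3₃ The ₃ LAWS and the letters at the W-family of record, frames with two compact places -/

/-- **Family-level ₃ LAWS from frame-wise v8 `Laws` at frames with two compact places** — twin of ★ `lawsV8_kitFamilyOfRecordW_of`: ★ `F0P3ThreadLetters3Defs.KitFamilyLaws₃`
IS the frame-wise statement with the extra binder `3 ≤ [L⁺:ℚ]` (definitional). [cite: Rogawski1990, §14.6 Thm. 14.6.4; Thm. 13.3.6 (c)] -/
theorem kitFamilyLaws₃_kitFamilyOfRecordW_of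
    (𝔇W : ∀ (L : Type) [Field L] [NumberField L] [IsCMField L] (ι : L →+* ℂ) (H : Matrix (Fin 3) (Fin 3) L) (T : GL (Fin 3) ℂ)
      (hT : (T : Matrix (Fin 3) (Fin 3) ℂ)ᴴ * H.map ι * (T : Matrix (Fin 3) (Fin 3) ℂ) = Literature.Geometry.ComplexHyperbolic.BallModel.J),
      (∀ τ' : L →+* ℂ, InfinitePlace.mk τ' ≠ InfinitePlace.mk ι → (H.map τ').PosDef) →
      2 ≤ Module.finrank ℚ ↥(maximalRealSubfield L) →
      ∀ (μ : Measure (Gp L H).automorphicQuotient) [(Gp L H).IsAutomorphicMeasure μ] (μω : HeckeCharacter L) (_hμu : μω.IsUnitary),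
      (∀ x : Literature.NumberTheory.GaloisRepresentations.ideleGroup ↥(maximalRealSubfield L),
        μω (AdeleRing.ideleBaseChange (↥(maximalRealSubfield L)) L x) = quadraticHeckeCharCM L x) → FrameDataW L H ι T hT μ)
    (hL : ∀ (L : Type) [Field L] [NumberField L] [IsCMField L] (ι : L →+* ℂ) (H : Matrix (Fin 3) (Fin 3) L) (T : GL (Fin 3) ℂ)
      (hT : (T : Matrix (Fin 3) (Fin 3) ℂ)ᴴ * H.map ι * (T : Matrix (Fin 3) (Fin 3) ℂ) = Literature.Geometry.ComplexHyperbolic.BallModel.J)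
      (hdef : ∀ τ' : L →+* ℂ, InfinitePlace.mk τ' ≠ InfinitePlace.mk ι → (H.map τ').PosDef) (h2 : 2 ≤ Module.finrank ℚ ↥(maximalRealSubfield L)) (h3 : 3 ≤ Module.finrank ℚ ↥(maximalRealSubfield L))
      (μ : Measure (Gp L H).automorphicQuotient) [(Gp L H).IsAutomorphicMeasure μ] (μω : HeckeCharacter L) (hμu : μω.IsUnitary)
      (hμω : ∀ x : Literature.NumberTheory.GaloisRepresentations.ideleGroup ↥(maximalRealSubfield L),
        μω (AdeleRing.ideleBaseChange (↥(maximalRealSubfield L)) L x) = quadraticHeckeCharCM L x),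
      ∃ S₀ : Finset (Places L), F0P3InnerFormClassificationV8.ClassificationKit.Laws (kitFamilyOfRecordW 𝔇W L ι H T hT hdef h2 μ μω hμu hμω) μω hμu S₀) :
    F0P3ThreadLetters3Defs.KitFamilyLaws₃ (kitFamilyOfRecordW 𝔇W) :=
  hL

/-- **THE HJ3a LINE'S ₃ LETTERS FROM THE ₃ LAWS AT THE FAMILY OF RECORD** — twin of ★ `letters_of_kitFamilyOfRecordV8W`: ★ (E-3b) `letters_of_guardedEngine₃` ∘ ★ (E-2)
`shapeGuarded₃_of_T5` at `kitFamilyOfRecordW 𝔇W`, pinned by ★ `isPinned_kitFamilyOfRecordW` (pins are `h2` objects), with the ₃ laws ⇒ ★ `F0P3ThreadLetters3Defs.StubE1coh₃`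
(`m(P) ≤ 1` on the cotangent locus at every compact CM frame with two compact places) ∧ ★ `F0P3ThreadLetters3Defs.HodgeTypeRigid₃` (E2′₃), BY NAME.
[cite: Rogawski1990, §14.6 Thm. 14.6.4; §15.3 ¶1; Prop. 15.2.1 (b); Thm. 13.3.6 (c)] [cite: BorelWallach2000, VI Thm. 4.11] -/
theorem letters_of_kitFamilyOfRecordV8W₃
    (𝔇W : ∀ (L : Type) [Field L] [NumberField L] [IsCMField L] (ι : L →+* ℂ) (H : Matrix (Fin 3) (Fin 3) L) (T : GL (Fin 3) ℂ)
      (hT : (T : Matrix (Fin 3) (Fin 3) ℂ)ᴴ * H.map ι * (T : Matrix (Fin 3) (Fin 3) ℂ) = Literature.Geometry.ComplexHyperbolic.BallModel.J),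
      (∀ τ' : L →+* ℂ, InfinitePlace.mk τ' ≠ InfinitePlace.mk ι → (H.map τ').PosDef) →
      2 ≤ Module.finrank ℚ ↥(maximalRealSubfield L) →
      ∀ (μ : Measure (Gp L H).automorphicQuotient) [(Gp L H).IsAutomorphicMeasure μ] (μω : HeckeCharacter L) (_hμu : μω.IsUnitary),
      (∀ x : Literature.NumberTheory.GaloisRepresentations.ideleGroup ↥(maximalRealSubfield L),
        μω (AdeleRing.ideleBaseChange (↥(maximalRealSubfield L)) L x) = quadraticHeckeCharCM L x) → FrameDataW L H ι T hT μ)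
    (hlaws₃ : F0P3ThreadLetters3Defs.KitFamilyLaws₃ (kitFamilyOfRecordW 𝔇W)) :
    F0P3ThreadLetters3Defs.StubE1coh₃ ∧ F0P3ThreadLetters3Defs.HodgeTypeRigid₃ :=
  letters_of_guardedEngine₃ (shapeGuarded₃_of_T5 (kitFamilyOfRecordW 𝔇W) (isPinned_kitFamilyOfRecordW 𝔇W) hlaws₃)

/-! ## §4₃ K9α at v8, GUARDED ROUTING, frames with two compact places — THE HEAD AGG's ₃ edition consumes -/

/-- **K9α AT v8, GUARDED ROUTING, ₃ EDITION — `letters_of_specPkgV8W_cot₃`** (twin of ★ `letters_of_specPkgV8W_cot`): for a family `𝔇W` of per-frame external data, IF at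
every letters' frame WITH TWO COMPACT PLACES (`3 ≤ [L⁺:ℚ]`) the kit of record satisfies the witnessed package `SpecPkg` and the NAMED rows #1, TF, #2, #6, #7, #8, #10, #15 in
their GUARDED v8 text, the arch clauses and the ξ-rows #20 #21 #23 — fourteen conjuncts at ONE level `S₀` per frame, VERBATIM — THEN the HJ3a line's two ₃ letters hold
(`letters_of_kitFamilyOfRecordV8W₃` ∘ ★ `laws₈_kitOfRecordW_of₄`, whose `h15` IS the guarded row).  AGG's ₃ edition: `letters_of_rung0₃ := letters_of_specPkgV8W_cot₃
frameDataOfRung0 rows_of_rung0₃`. [cite: Rogawski1990, §14.6 Thm. 14.6.4 pp. 236–244; §15.3 ¶1 p. 244; Prop. 15.2.1 (b); Thm. 13.3.6 (c)] [cite: BorelWallach2000, VI Thm. 4.11] -/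
theorem letters_of_specPkgV8W_cot₃
    (𝔇W : ∀ (L : Type) [Field L] [NumberField L] [IsCMField L] (ι : L →+* ℂ) (H : Matrix (Fin 3) (Fin 3) L) (T : GL (Fin 3) ℂ)
      (hT : (T : Matrix (Fin 3) (Fin 3) ℂ)ᴴ * H.map ι * (T : Matrix (Fin 3) (Fin 3) ℂ) = Literature.Geometry.ComplexHyperbolic.BallModel.J),
      (∀ τ' : L →+* ℂ, InfinitePlace.mk τ' ≠ InfinitePlace.mk ι → (H.map τ').PosDef) →
      2 ≤ Module.finrank ℚ ↥(maximalRealSubfield L) →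
      ∀ (μ : Measure (Gp L H).automorphicQuotient) [(Gp L H).IsAutomorphicMeasure μ] (μω : HeckeCharacter L) (_hμu : μω.IsUnitary),
      (∀ x : Literature.NumberTheory.GaloisRepresentations.ideleGroup ↥(maximalRealSubfield L),
        μω (AdeleRing.ideleBaseChange (↥(maximalRealSubfield L)) L x) = quadraticHeckeCharCM L x) → FrameDataW L H ι T hT μ)
    (h : ∀ (L : Type) [Field L] [NumberField L] [IsCMField L] (ι : L →+* ℂ) (H : Matrix (Fin 3) (Fin 3) L) (T : GL (Fin 3) ℂ)
      (hT : (T : Matrix (Fin 3) (Fin 3) ℂ)ᴴ * H.map ι * (T : Matrix (Fin 3) (Fin 3) ℂ) = Literature.Geometry.ComplexHyperbolic.BallModel.J)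
      (hdef : ∀ τ' : L →+* ℂ, InfinitePlace.mk τ' ≠ InfinitePlace.mk ι → (H.map τ').PosDef) (h2 : 2 ≤ Module.finrank ℚ ↥(maximalRealSubfield L)) (h3 : 3 ≤ Module.finrank ℚ ↥(maximalRealSubfield L))
      (μ : Measure (Gp L H).automorphicQuotient) [(Gp L H).IsAutomorphicMeasure μ] (μω : HeckeCharacter L) (hμu : μω.IsUnitary)
      (hμω : ∀ x : Literature.NumberTheory.GaloisRepresentations.ideleGroup ↥(maximalRealSubfield L),
        μω (AdeleRing.ideleBaseChange (↥(maximalRealSubfield L)) L x) = quadraticHeckeCharCM L x),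
      -- ONE level `S₀` per frame (v8, RULING (V44)); the witnessed package at `S₀` (K9β: `Classical.choose_spec`, unioned by `.mono`)
      ∃ S₀ : Finset (Places L),
      F0P3InnerFormClassificationV8.ClassificationKit.SpecPkg (kitFamilyOfRecordW 𝔇W L ι H T hT hdef h2 μ μω hμu hμω) S₀ ∧
      -- #1 (T1's head at the overridden kit, K9β §A), TF (class factorisation), #2, #6, #7, #8, #10, #15 (v8 text, GUARDED `IsCot P → KcTrivial P → …` — ★ `routing₈_kitOfRecord_of_cot`)
      (kitFamilyOfRecordW 𝔇W L ι H T hT hdef h2 μ μω hμu hμω).TraceIdentity ∧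
      F0P3InnerFormClassificationV8.ClassificationKit.FactorisationCls (kitFamilyOfRecordW 𝔇W L ι H T hT hdef h2 μ μω hμu hμω) S₀ ∧
      (kitFamilyOfRecordW 𝔇W L ι H T hT hdef h2 μ μω hμu hμω).SpectralSideGp ∧
      F0P3InnerFormClassificationV8.ClassificationKit.HatBounded (kitFamilyOfRecordW 𝔇W L ι H T hT hdef h2 μ μω hμu hμω) S₀ ∧
      F0P3InnerFormClassificationV8.ClassificationKit.UnrStarAlgebra (kitFamilyOfRecordW 𝔇W L ι H T hT hdef h2 μ μω hμu hμω) S₀ ∧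
      (kitFamilyOfRecordW 𝔇W L ι H T hT hdef h2 μ μω hμu hμω).LinIndepS ∧
      F0P3InnerFormClassificationV8.ClassificationKit.UnitaryPacket (kitFamilyOfRecordW 𝔇W L ι H T hT hdef h2 μ μω hμu hμω) S₀ ∧
      F0P3InnerFormClassificationV8.ClassificationKit.Routing (kitFamilyOfRecordW 𝔇W L ι H T hT hdef h2 μ μω hμu hμω) ∧
      -- the arch clauses on the family's `jInf dsInf` (R-22′) and the ξ-rows #20 #21 #23 (no #12 `FlathDet`, no «AFA»: RULINGS (V43)(V44))
      JInfNoDegOne (𝔇W L ι H T hT hdef h2 μ μω hμu hμω).jInf ∧ DsInfNoDegOne (𝔇W L ι H T hT hdef h2 μ μω hμu hμω).dsInf ∧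
      (kitFamilyOfRecordW 𝔇W L ι H T hT hdef h2 μ μω hμu hμω).XiFamilyFin μω hμu ∧
      (kitFamilyOfRecordW 𝔇W L ι H T hT hdef h2 μ μω hμu hμω).XiUnram ∧
      (kitFamilyOfRecordW 𝔇W L ι H T hT hdef h2 μ μω hμu hμω).EvpConvention) :
    F0P3ThreadLetters3Defs.StubE1coh₃ ∧ F0P3ThreadLetters3Defs.HodgeTypeRigid₃ := by
  refine letters_of_kitFamilyOfRecordV8W₃ 𝔇W fun L _ _ _ ι H T hT hdef h2 h3 μ _ μω hμu hμω => ?_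
  obtain ⟨S₀, hpk, h1, hTF, h2', h6, h7, h8, h10, h15, hJ, hD, h20, h21, h23⟩ := h L ι H T hT hdef h2 h3 μ μω hμu hμω
  letI : MeasurableSpace (Gp L H).Adelic := borel _
  haveI : BorelSpace (Gp L H).Adelic := ⟨rfl⟩
  haveI := (𝔇W L ι H T hT hdef h2 μ μω hμu hμω).isFiniteMeasureOnCompacts_ν
  exact ⟨S₀, laws₈_kitOfRecordW_of₄ L H ι T hT μ _ _ _ μω hμu _ _ _ _ _ _ _ _ S₀ hdef h2 h1 h2'
    (F0P3InnerFormClassificationV8.ClassificationKit.factorisation_of_cls_of_pk _ hTF hpk.factorisationPk) hpk.matchingS hpk.transferS h6 h7 h8 h10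
    hpk.aPacketSpectral hpk.localExpansion h15 hμω hJ hD h20 h21 h23⟩

end Summit.HodgeConjecture.HodgeConjecture.Cruxes.H413.F0P3KitOfRecordLawsV8W3

end
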